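import Literature.Analysis.FluidPDE.PineauVicolPressureDecayClass
import Literature.Analysis.FluidPDE.MorreyLargeScale
import HarnessLib

/-!
# Route SqueezeCycle · item `SingularProfileOfNontrivial` (stmt-NavierStokesRegularity-15368):
# parametric integrals of decaying kernels against MORREY weights

Helper file (theorems only) for the bridge `SqueezeCycle.SingularProfileOfNontrivial` (𝒦_C →
Albritton–Barker's class). The slab-wide bound `𝐈 < ∞` for a member of 𝒦_C needs the pressure
representation `∇q(t) = ∇Q[u(t)]` (`Q` = the tree's `pressurePotential`) for velocity slices
which are neither square integrable nor decaying, but obey the scale-invariant MORREY bound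
`∫_{B(x,r)} |v|² ≤ A r` (`r ≥ 1`). This file is the Morrey-class twin of the kernel section of
`PineauVicolPressureDecayClass.lean` (decay class `(1+|y|)|v| ≤ C`):

* `integral_mul_inv_cube_le_of_morrey` — the dyadic bound
  `∫ w(y) (1+|x₀−y|)⁻³ dy ≤ 4 A` for a continuous density `w ≥ 0` with `∫_{B(x,r)} w ≤ A r`
  (`r ≥ 1`), with integrability (the tree's `lintegral_mul_le_of_dyadic_morrey` on the shells
  `2ᵏ ≤ |y − x₀| < 2ᵏ⁺¹`);
* the parametric-integral lemmas `…_integral_clm_apply_comp_sub_morrey` for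
  `x ↦ ∫ L(y)(Φ(x − y)) dy` with a kernel `‖DᵏΦ(z)‖ ≤ M (1+|z|)⁻³` (`HasDecay 3`) and a
  continuous operator weight `L` whose norm is a Morrey density (dominators
  `8M ‖L y‖ (1+|x₀−y|)⁻³` on unit balls in `x`).

References: T. Tao, Anal. PDE 6 (2013), §4 [Tao2011]; D. Albritton, T. Barker, J. Math. Fluid
Mech. 21 (2019) = arXiv:1811.00502, §1 [AlbrittonBarker2019].
-/

noncomputable section

-- the sub-problem namespace repeats the summit name (D-0017 layout `Summit.<S>.<P>.Theorems`)
set_option linter.dupNamespace false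

namespace Summit.NavierStokesRegularity.NavierStokesRegularity.Theorems.SingularProfile

open MeasureTheory Set Filter Metric Function
open _root_.Topology
open scoped ENNReal NNReal
open Literature.Analysis.FluidPDE
open Literature.Analysis.FluidPDE.FourierNS (HasDecay)

/-! ### The dyadic bound for Morrey densities -/

section Dyadic

/-- A Morrey density at scales `≥ 1` has a nonnegative constant (test on the unit ball). [folklore] -/
theorem morrey_const_nonneg {w : (EuclideanSpace ℝ (Fin 3)) → ℝ} (hw0 : ∀ y, 0 ≤ w y) {A : ℝ}
    (hA : ∀ (x : (EuclideanSpace ℝ (Fin 3))) (r : ℝ), 1 ≤ r → ∫ y in ball x r, w y ≤ A * r) : 0 ≤ A := by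
  have h := hA 0 1 le_rfl
  rw [mul_one] at h
  exact (setIntegral_nonneg measurableSet_ball fun y _ => hw0 y).trans h

/-- Translating a ball integral to the origin: `∫_{B(0,r)} w(x + y) dy = ∫_{B(x,r)} w`. [folklore] -/
theorem setIntegral_ball_comp_add_left (w : (EuclideanSpace ℝ (Fin 3)) → ℝ) (x : (EuclideanSpace ℝ (Fin 3))) (r : ℝ) :
    ∫ y in ball (0 : EuclideanSpace ℝ (Fin 3)) r, w (x + y) = ∫ y in ball x r, w y := by
  have hpre : (fun y : (EuclideanSpace ℝ (Fin 3)) => x + y) ⁻¹' ball x r = ball 0 r := by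
    ext y
    simp [mem_ball, dist_eq_norm]
  rw [← hpre]
  exact (measurePreserving_add_left volume x).setIntegral_preimage_emb
    (Homeomorph.addLeft x).measurableEmbedding w (ball x r)

/-- The shell coefficient: `(1 + 2ᵏ)⁻³ · (A 2ᵏ⁺¹) ≤ 2A (1/4)ᵏ`. [folklore] -/
theorem shell_coeff_le {A : ℝ} (hA : 0 ≤ A) (k : ℕ) :
    ((1 + (1 : ℝ) * 2 ^ k) ^ 3)⁻¹ * (A * ((1 : ℝ) * 2 ^ (k + 1))) ≤ 2 * A * (1 / 4) ^ k := by
  have h2k : (0 : ℝ) < 2 ^ k := by positivity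
  have h1 : ((1 + (1 : ℝ) * 2 ^ k) ^ 3)⁻¹ ≤ ((2 : ℝ) ^ k)⁻¹ ^ 3 := by
    rw [← inv_pow]
    refine pow_le_pow_left₀ (by positivity) ?_ 3
    exact inv_anti₀ h2k (by linarith)
  have h4 : ((1 : ℝ) / 4) ^ k = ((2 : ℝ) ^ k)⁻¹ ^ 2 := by
    rw [inv_pow, ← pow_mul, show (2 : ℝ) ^ (k * 2) = 4 ^ k by rw [mul_comm, pow_mul]; norm_num,
      one_div, inv_pow]
  rw [h4]
  calc ((1 + (1 : ℝ) * 2 ^ k) ^ 3)⁻¹ * (A * ((1 : ℝ) * 2 ^ (k + 1)))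
      ≤ ((2 : ℝ) ^ k)⁻¹ ^ 3 * (A * ((1 : ℝ) * 2 ^ (k + 1))) :=
        mul_le_mul_of_nonneg_right h1 (by positivity)
    _ = 2 * A * ((2 : ℝ) ^ k)⁻¹ ^ 2 := by
        rw [pow_succ]; field_simp; ring

/-- **The dyadic bound for a Morrey density.** If `w ≥ 0` is continuous with
`∫_{B(x,r)} w ≤ A r` for all centres `x` and radii `r ≥ 1`, then for every `x₀` the function
`y ↦ w(y) (1+|x₀−y|)⁻³` is integrable with `∫ w(y)(1+|x₀−y|)⁻³ dy ≤ 4A` (unit ball: `≤ A`;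
shell `2ᵏ ≤ |y−x₀| < 2ᵏ⁺¹`: `≤ 2⁻³ᵏ · A 2ᵏ⁺¹`; `A(1 + 8/3) ≤ 4A`). [folklore] -/
theorem integral_mul_inv_cube_le_of_morrey {w : (EuclideanSpace ℝ (Fin 3)) → ℝ} (hwc : Continuous w) (hw0 : ∀ y, 0 ≤ w y)
    {A : ℝ} (hA : ∀ (x : (EuclideanSpace ℝ (Fin 3))) (r : ℝ), 1 ≤ r → ∫ y in ball x r, w y ≤ A * r) (x₀ : (EuclideanSpace ℝ (Fin 3))) :
    Integrable (fun y => w y * ((1 + ‖x₀ - y‖) ^ 3)⁻¹) ∧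
      ∫ y, w y * ((1 + ‖x₀ - y‖) ^ 3)⁻¹ ≤ 4 * A := by
  have hA0 : 0 ≤ A := morrey_const_nonneg hw0 hA
  set F : (EuclideanSpace ℝ (Fin 3)) → ℝ := fun y => w y * ((1 + ‖x₀ - y‖) ^ 3)⁻¹ with hF
  have hF0 : ∀ y, 0 ≤ F y := fun y => mul_nonneg (hw0 y) (by positivity)
  have hden : Continuous fun y : (EuclideanSpace ℝ (Fin 3)) => ((1 + ‖x₀ - y‖) ^ 3)⁻¹ :=
    Continuous.inv₀ (by fun_prop) fun y => by positivity
  have hFc : Continuous F := hwc.mul hden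
  -- the lintegral of `F`, moved to the origin
  set wt : ℝ → ℝ≥0∞ := fun r => ENNReal.ofReal (((1 + r) ^ 3)⁻¹) with hwt
  set g : (EuclideanSpace ℝ (Fin 3)) → ℝ≥0∞ := fun y => ENNReal.ofReal (w (x₀ + y)) with hg
  have hshift : ∫⁻ y, ENNReal.ofReal (F y) = ∫⁻ y, wt ‖y‖ * g y := by
    rw [← lintegral_add_left_eq_self (fun y => ENNReal.ofReal (F y)) x₀]
    refine lintegral_congr fun y => ?_
    simp only [hF, hwt, hg]
    rw [mul_comm, ENNReal.ofReal_mul (by positivity), sub_add_cancel_left, norm_neg]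
  -- the dyadic lemma
  have hwtanti : AntitoneOn wt (Ici 0) := by
    intro r₁ hr₁ r₂ _ h12
    have h0 : (0 : ℝ) ≤ r₁ := hr₁
    refine ENNReal.ofReal_le_ofReal (inv_anti₀ (by positivity) ?_)
    exact pow_le_pow_left₀ (by positivity) (by linarith) 3
  have hG : ∀ r, (1 : ℝ) ≤ r → ∫⁻ y in ball (0 : EuclideanSpace ℝ (Fin 3)) r, g y ≤ ENNReal.ofReal (A * r) := by
    intro r hr
    have hint : IntegrableOn (fun y => w (x₀ + y)) (ball (0 : EuclideanSpace ℝ (Fin 3)) r) volume :=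
      ((hwc.comp (continuous_const.add continuous_id)).continuousOn.integrableOn_compact
        (isCompact_closedBall 0 r)).mono_set ball_subset_closedBall
    rw [hg, ← ofReal_integral_eq_lintegral_ofReal hint (ae_of_all _ fun y => hw0 _),
      setIntegral_ball_comp_add_left w x₀ r]
    exact ENNReal.ofReal_le_ofReal (hA x₀ r hr)
  have hmain := lintegral_mul_le_of_dyadic_morrey (μ := (volume : Measure (EuclideanSpace ℝ (Fin 3)))) (w := fun y => wt ‖y‖)
    (g := g) (G := fun r => ENNReal.ofReal (A * r)) one_pos hwtanti (fun _ => ENNReal.ofReal_ne_top)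
    (fun _ => le_rfl) hG
  -- evaluation of the right-hand side
  have h0 : wt 0 * ENNReal.ofReal (A * 1) = ENNReal.ofReal A := by
    simp [hwt]
  have hk : ∀ k : ℕ, wt (1 * 2 ^ k) * ENNReal.ofReal (A * (1 * 2 ^ (k + 1))) ≤
      ENNReal.ofReal (2 * A * (1 / 4) ^ k) := by
    intro k
    simp only [hwt]
    rw [← ENNReal.ofReal_mul (by positivity)]
    exact ENNReal.ofReal_le_ofReal (shell_coeff_le hA0 k)
  have hgeom : Summable fun k : ℕ => 2 * A * ((1 : ℝ) / 4) ^ k :=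
    (summable_geometric_of_lt_one (by norm_num) (by norm_num)).mul_left _
  have hsum : ∑' k : ℕ, wt (1 * 2 ^ k) * ENNReal.ofReal (A * (1 * 2 ^ (k + 1))) ≤
      ENNReal.ofReal (8 / 3 * A) := by
    calc ∑' k : ℕ, wt (1 * 2 ^ k) * ENNReal.ofReal (A * (1 * 2 ^ (k + 1)))
        ≤ ∑' k : ℕ, ENNReal.ofReal (2 * A * (1 / 4) ^ k) := ENNReal.tsum_le_tsum hk
      _ = ENNReal.ofReal (∑' k : ℕ, 2 * A * (1 / 4) ^ k) :=
          (ENNReal.ofReal_tsum_of_nonneg (fun k => by positivity) hgeom).symm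
      _ = ENNReal.ofReal (8 / 3 * A) := by
          rw [tsum_mul_left, tsum_geometric_of_lt_one (by norm_num) (by norm_num)]
          ring_nf
  have hlin : ∫⁻ y, ENNReal.ofReal (F y) ≤ ENNReal.ofReal (11 / 3 * A) := by
    rw [hshift]
    refine hmain.trans ?_
    rw [h0]
    calc ENNReal.ofReal A + ∑' k : ℕ, wt (1 * 2 ^ k) * ENNReal.ofReal (A * (1 * 2 ^ (k + 1)))
        ≤ ENNReal.ofReal A + ENNReal.ofReal (8 / 3 * A) := add_le_add le_rfl hsum
      _ = ENNReal.ofReal (11 / 3 * A) := by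
          rw [← ENNReal.ofReal_add hA0 (by positivity)]; ring_nf
  -- integrability and the bound
  have hFi : Integrable F := by
    refine ⟨hFc.aestronglyMeasurable, ?_⟩
    rw [hasFiniteIntegral_iff_ofReal (ae_of_all _ hF0)]
    exact lt_of_le_of_lt hlin ENNReal.ofReal_lt_top
  refine ⟨hFi, ?_⟩
  have h1 : ENNReal.ofReal (∫ y, F y) ≤ ENNReal.ofReal (11 / 3 * A) := by
    rw [ofReal_integral_eq_lintegral_ofReal hFi (ae_of_all _ hF0)]
    exact hlin
  have h2 : ∫ y, F y ≤ 11 / 3 * A := (ENNReal.ofReal_le_ofReal_iff (by positivity)).1 h1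
  linarith

/-- **Localised comparison of the weights**: for `|x − x₀| < 1`,
`(1+|x−y|)⁻³ ≤ 8 (1+|x₀−y|)⁻³` (since `1 + |x₀ − y| ≤ 2 (1 + |x − y|)`). [folklore] -/
theorem inv_cube_le_of_mem_ball {x₀ x : (EuclideanSpace ℝ (Fin 3))} (hx : ‖x - x₀‖ < 1) (y : (EuclideanSpace ℝ (Fin 3))) :
    ((1 + ‖x - y‖) ^ 3)⁻¹ ≤ 8 * ((1 + ‖x₀ - y‖) ^ 3)⁻¹ := by
  have h1 : 0 < 1 + ‖x - y‖ := by positivity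
  have h2 : 0 < 1 + ‖x₀ - y‖ := by positivity
  have hle : 1 + ‖x₀ - y‖ ≤ 2 * (1 + ‖x - y‖) := by
    have : ‖x₀ - y‖ ≤ ‖x₀ - x‖ + ‖x - y‖ := norm_sub_le_norm_sub_add_norm_sub x₀ x y
    rw [norm_sub_rev x₀ x] at this
    linarith [norm_nonneg (x - y)]
  have h3 : (1 + ‖x₀ - y‖) ^ 3 ≤ 8 * (1 + ‖x - y‖) ^ 3 := by
    calc (1 + ‖x₀ - y‖) ^ 3 ≤ (2 * (1 + ‖x - y‖)) ^ 3 := pow_le_pow_left₀ h2.le hle 3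
      _ = 8 * (1 + ‖x - y‖) ^ 3 := by ring
  rw [show (8 : ℝ) * ((1 + ‖x₀ - y‖) ^ 3)⁻¹ = ((1 + ‖x₀ - y‖) ^ 3 / 8)⁻¹ by
    rw [inv_div]; ring]
  exact inv_anti₀ (by positivity) (by linarith)

end Dyadic

/-! ### Parametric integrals: decaying kernels against Morrey operator weights -/

section Kernel

variable {F : Type*} [NormedAddCommGroup F] [NormedSpace ℝ F]
variable {G : Type*} [NormedAddCommGroup G] [NormedSpace ℝ G]

omit [NormedSpace ℝ F] [NormedSpace ℝ G] in
/-- The pointwise dominator: for `‖Φ(z)‖ ≤ M (1+|z|)⁻³` and `|x − x₀| < 1`,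
`‖L y‖ ‖Φ(x − y)‖ ≤ 8 M ‖L y‖ (1+|x₀−y|)⁻³`. [folklore] -/
theorem norm_mul_norm_comp_sub_le_morrey {Φ : (EuclideanSpace ℝ (Fin 3)) → F} {L : (EuclideanSpace ℝ (Fin 3)) → G} {M : ℝ} (hΦ : HasDecay 3 M Φ)
    {x₀ x : (EuclideanSpace ℝ (Fin 3))} (hx : ‖x - x₀‖ < 1) (y : (EuclideanSpace ℝ (Fin 3))) :
    ‖L y‖ * ‖Φ (x - y)‖ ≤ 8 * M * (‖L y‖ * ((1 + ‖x₀ - y‖) ^ 3)⁻¹) := by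
  have hM := hΦ.nonneg
  calc ‖L y‖ * ‖Φ (x - y)‖ ≤ ‖L y‖ * (M * ((1 + ‖x - y‖) ^ 3)⁻¹) :=
        mul_le_mul_of_nonneg_left (hΦ _) (norm_nonneg _)
    _ ≤ ‖L y‖ * (M * (8 * ((1 + ‖x₀ - y‖) ^ 3)⁻¹)) := by
        gcongr
        exact inv_cube_le_of_mem_ball hx y
    _ = 8 * M * (‖L y‖ * ((1 + ‖x₀ - y‖) ^ 3)⁻¹) := by ring

omit [NormedSpace ℝ F] [NormedSpace ℝ G] in
/-- The exact dominator at the centre: `‖L y‖ ‖Φ(x − y)‖ ≤ M ‖L y‖ (1+|x−y|)⁻³`. [folklore] -/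
theorem norm_mul_norm_comp_sub_le_morrey' {Φ : (EuclideanSpace ℝ (Fin 3)) → F} {L : (EuclideanSpace ℝ (Fin 3)) → G} {M : ℝ} (hΦ : HasDecay 3 M Φ)
    (x y : (EuclideanSpace ℝ (Fin 3))) : ‖L y‖ * ‖Φ (x - y)‖ ≤ M * (‖L y‖ * ((1 + ‖x - y‖) ^ 3)⁻¹) := by
  calc ‖L y‖ * ‖Φ (x - y)‖ ≤ ‖L y‖ * (M * ((1 + ‖x - y‖) ^ 3)⁻¹) :=
        mul_le_mul_of_nonneg_left (hΦ _) (norm_nonneg _)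
    _ = M * (‖L y‖ * ((1 + ‖x - y‖) ^ 3)⁻¹) := by ring

omit [NormedSpace ℝ G] in
/-- The integrable dominator `y ↦ K ‖L y‖ (1+|x₀−y|)⁻³` of a continuous Morrey operator weight.
[folklore] -/
theorem integrable_dominator_morrey {L : (EuclideanSpace ℝ (Fin 3)) → G} (hLc : Continuous L) {A : ℝ}
    (hL : ∀ (x : (EuclideanSpace ℝ (Fin 3))) (r : ℝ), 1 ≤ r → ∫ y in ball x r, ‖L y‖ ≤ A * r) (K : ℝ) (x₀ : (EuclideanSpace ℝ (Fin 3))) :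
    Integrable fun y => K * (‖L y‖ * ((1 + ‖x₀ - y‖) ^ 3)⁻¹) :=
  ((integral_mul_inv_cube_le_of_morrey hLc.norm (fun _ => norm_nonneg _) hL x₀).1).const_mul K

/-- **Integrability** of `y ↦ L(y)(Φ(x - y))` for a continuous kernel with `‖Φ(z)‖ ≤ M(1+|z|)⁻³`
and a continuous operator weight `L` whose norm is a Morrey density, with the bound
`∫ ‖L(y)(Φ(x−y))‖ dy ≤ 4 M A`. [folklore] -/
theorem integrable_clm_apply_comp_sub_morrey {Φ : (EuclideanSpace ℝ (Fin 3)) → F} {L : (EuclideanSpace ℝ (Fin 3)) → F →L[ℝ] G} (hΦc : Continuous Φ)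
    {M A : ℝ} (hΦ : HasDecay 3 M Φ) (hLc : Continuous L)
    (hL : ∀ (x : (EuclideanSpace ℝ (Fin 3))) (r : ℝ), 1 ≤ r → ∫ y in ball x r, ‖L y‖ ≤ A * r) (x : (EuclideanSpace ℝ (Fin 3))) :
    Integrable (fun y => L y (Φ (x - y))) ∧ ∫ y, ‖L y (Φ (x - y))‖ ≤ 4 * M * A := by
  obtain ⟨hI, hbd⟩ := integral_mul_inv_cube_le_of_morrey hLc.norm (fun _ => norm_nonneg _) hL x
  have hpt : ∀ y, ‖L y (Φ (x - y))‖ ≤ M * (‖L y‖ * ((1 + ‖x - y‖) ^ 3)⁻¹) := fun y =>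
    (ContinuousLinearMap.le_opNorm _ _).trans (norm_mul_norm_comp_sub_le_morrey' hΦ x y)
  have hmeas : AEStronglyMeasurable (fun y => L y (Φ (x - y))) volume :=
    (hLc.clm_apply (hΦc.comp (continuous_const.sub continuous_id))).aestronglyMeasurable
  refine ⟨Integrable.mono' (hI.const_mul M) hmeas (Eventually.of_forall hpt), ?_⟩
  calc ∫ y, ‖L y (Φ (x - y))‖ ≤ ∫ y, M * (‖L y‖ * ((1 + ‖x - y‖) ^ 3)⁻¹) :=
        integral_mono_of_nonneg (Eventually.of_forall fun _ => norm_nonneg _) (hI.const_mul M)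
          (Eventually.of_forall hpt)
    _ = M * ∫ y, ‖L y‖ * ((1 + ‖x - y‖) ^ 3)⁻¹ := integral_const_mul _ _
    _ ≤ M * (4 * A) := mul_le_mul_of_nonneg_left hbd hΦ.nonneg
    _ = 4 * M * A := by ring

/-- **The norm bound** `‖∫ L(y)(Φ(x − y)) dy‖ ≤ 4 M A` (Morrey weight). [folklore] -/
theorem norm_integral_clm_apply_comp_sub_le_morrey {Φ : (EuclideanSpace ℝ (Fin 3)) → F} {L : (EuclideanSpace ℝ (Fin 3)) → F →L[ℝ] G}
    (hΦc : Continuous Φ) {M A : ℝ} (hΦ : HasDecay 3 M Φ) (hLc : Continuous L)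
    (hL : ∀ (x : (EuclideanSpace ℝ (Fin 3))) (r : ℝ), 1 ≤ r → ∫ y in ball x r, ‖L y‖ ≤ A * r) (x : (EuclideanSpace ℝ (Fin 3))) :
    ‖∫ y, L y (Φ (x - y))‖ ≤ 4 * M * A :=
  (norm_integral_le_integral_norm _).trans (integrable_clm_apply_comp_sub_morrey hΦc hΦ hLc hL x).2

/-- **Continuity** of `x ↦ ∫ L(y)(Φ(x - y)) dy` (decaying kernel, Morrey weight; dominated
convergence on unit balls with the dominator `8M ‖L y‖ (1+|x₀−y|)⁻³`). [folklore] -/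
theorem continuous_integral_clm_apply_comp_sub_morrey {Φ : (EuclideanSpace ℝ (Fin 3)) → F} {L : (EuclideanSpace ℝ (Fin 3)) → F →L[ℝ] G}
    (hΦc : Continuous Φ) {M A : ℝ} (hΦ : HasDecay 3 M Φ) (hLc : Continuous L)
    (hL : ∀ (x : (EuclideanSpace ℝ (Fin 3))) (r : ℝ), 1 ≤ r → ∫ y in ball x r, ‖L y‖ ≤ A * r) :
    Continuous fun x => ∫ y, L y (Φ (x - y)) := by
  refine continuous_iff_continuousAt.2 fun x₀ => ?_
  have hmeas : ∀ x, AEStronglyMeasurable (fun y => L y (Φ (x - y))) volume := fun x =>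
    (hLc.clm_apply (hΦc.comp (continuous_const.sub continuous_id))).aestronglyMeasurable
  refine continuousAt_of_dominated (bound := fun y => 8 * M * (‖L y‖ * ((1 + ‖x₀ - y‖) ^ 3)⁻¹))
    (Eventually.of_forall hmeas) ?_ (integrable_dominator_morrey hLc hL _ x₀) ?_
  · have hball : ball x₀ 1 ∈ 𝓝 x₀ := ball_mem_nhds x₀ one_pos
    filter_upwards [hball] with x hx
    exact Eventually.of_forall fun y =>
      (ContinuousLinearMap.le_opNorm _ _).trans (norm_mul_norm_comp_sub_le_morrey hΦ (mem_ball_iff_norm.1 hx) y)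
  · exact Eventually.of_forall fun y =>
      ((L y).continuous.comp (hΦc.comp (continuous_id.sub continuous_const))).continuousAt

/-- **Differentiation under the integral sign** for `x ↦ ∫ L(y)(Φ(x - y)) dy` with `Φ ∈ C¹`,
`Φ` and `DΦ` decaying like `(1+|z|)⁻³`, and a Morrey operator weight: the derivative is
`∫ L(y) ∘ DΦ(x - y) dy`. [folklore] -/
theorem hasFDerivAt_integral_clm_apply_comp_sub_morrey {Φ : (EuclideanSpace ℝ (Fin 3)) → F} {L : (EuclideanSpace ℝ (Fin 3)) → F →L[ℝ] G}
    (hΦ1 : ContDiff ℝ 1 Φ) {M₀ M₁ A : ℝ} (hM₀ : HasDecay 3 M₀ Φ) (hM₁ : HasDecay 3 M₁ (fderiv ℝ Φ))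
    (hLc : Continuous L) (hL : ∀ (x : (EuclideanSpace ℝ (Fin 3))) (r : ℝ), 1 ≤ r → ∫ y in ball x r, ‖L y‖ ≤ A * r)
    (x₀ : (EuclideanSpace ℝ (Fin 3))) :
    HasFDerivAt (fun x => ∫ y, L y (Φ (x - y))) (∫ y, (L y).comp (fderiv ℝ Φ (x₀ - y))) x₀ := by
  have hΦc : Continuous Φ := hΦ1.continuous
  have hDΦ : Continuous (fderiv ℝ Φ) := hΦ1.continuous_fderiv one_ne_zero
  refine hasFDerivAt_integral_of_dominated_of_fderiv_le
    (F' := fun x y => (L y).comp (fderiv ℝ Φ (x - y)))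
    (bound := fun y => 8 * M₁ * (‖L y‖ * ((1 + ‖x₀ - y‖) ^ 3)⁻¹)) (ball_mem_nhds x₀ one_pos)
    ?_ ?_ ?_ ?_ ?_ ?_
  · exact Eventually.of_forall fun x =>
      (hLc.clm_apply (hΦc.comp (continuous_const.sub continuous_id))).aestronglyMeasurable
  · exact (integrable_clm_apply_comp_sub_morrey hΦc hM₀ hLc hL x₀).1
  · exact (hLc.clm_comp (hDΦ.comp (continuous_const.sub continuous_id))).aestronglyMeasurable
  · refine Eventually.of_forall fun y x hx => (ContinuousLinearMap.opNorm_comp_le _ _).trans ?_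
    exact norm_mul_norm_comp_sub_le_morrey hM₁ (mem_ball_iff_norm.1 hx) y
  · exact integrable_dominator_morrey hLc hL _ x₀
  · refine Eventually.of_forall fun y x _ => ?_
    have h1 : HasFDerivAt (fun x : (EuclideanSpace ℝ (Fin 3)) => Φ (x - y)) (fderiv ℝ Φ (x - y)) x := by
      have := ((hΦ1.differentiable one_ne_zero) (x - y)).hasFDerivAt.comp x (hasFDerivAt_sub_const y)
      rwa [ContinuousLinearMap.comp_id] at this
    exact (L y).hasFDerivAt.comp x h1

/-- The directional derivative formula `∂ₐ ∫ L(y)(Φ(x - y)) dy = ∫ L(y)(DΦ(x - y) a) dy`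
(Morrey weight). [folklore] -/
theorem fderiv_integral_clm_apply_comp_sub_apply_morrey [CompleteSpace G] {Φ : (EuclideanSpace ℝ (Fin 3)) → F}
    {L : (EuclideanSpace ℝ (Fin 3)) → F →L[ℝ] G} (hΦ1 : ContDiff ℝ 1 Φ) {M₀ M₁ A : ℝ} (hM₀ : HasDecay 3 M₀ Φ)
    (hM₁ : HasDecay 3 M₁ (fderiv ℝ Φ)) (hLc : Continuous L)
    (hL : ∀ (x : (EuclideanSpace ℝ (Fin 3))) (r : ℝ), 1 ≤ r → ∫ y in ball x r, ‖L y‖ ≤ A * r) (x a : (EuclideanSpace ℝ (Fin 3))) :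
    fderiv ℝ (fun x => ∫ y, L y (Φ (x - y))) x a = ∫ y, L y (fderiv ℝ Φ (x - y) a) := by
  rw [(hasFDerivAt_integral_clm_apply_comp_sub_morrey hΦ1 hM₀ hM₁ hLc hL x).fderiv,
    ContinuousLinearMap.integral_apply]
  · rfl
  · have hDΦ : Continuous (fderiv ℝ Φ) := hΦ1.continuous_fderiv one_ne_zero
    obtain ⟨hI, -⟩ := integral_mul_inv_cube_le_of_morrey hLc.norm (fun _ => norm_nonneg _) hL x
    refine Integrable.mono' (hI.const_mul M₁)
      (hLc.clm_comp (hDΦ.comp (continuous_const.sub continuous_id))).aestronglyMeasurable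
      (Eventually.of_forall fun y => (ContinuousLinearMap.opNorm_comp_le _ _).trans
        (norm_mul_norm_comp_sub_le_morrey' hM₁ x y))

-- nested operator types `((EuclideanSpace ℝ (Fin 3)) →L[ℝ] F) →L[ℝ] (EuclideanSpace ℝ (Fin 3)) →L[ℝ] G`
set_option maxSynthPendingDepth 3 in
/-- **`C²` regularity** of `x ↦ ∫ L(y)(Φ(x - y)) dy` for `Φ ∈ C²` with `Φ`, `DΦ`, `D²Φ` decaying
like `(1+|z|)⁻³` and a continuous Morrey operator weight `L` (NOT integrable, not decaying), with
the formula `∂ₐ∂ₐ ∫ L(y)(Φ(x - y)) dy = ∫ L(y)(D²Φ(x - y)(a, a)) dy`. Verbatim the decay-class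
`contDiff_two_integral_clm_apply_comp_sub_decay` with the Morrey dominators. [folklore] -/
theorem contDiff_two_integral_clm_apply_comp_sub_morrey [CompleteSpace G] {Φ : (EuclideanSpace ℝ (Fin 3)) → F}
    {L : (EuclideanSpace ℝ (Fin 3)) → F →L[ℝ] G} (hΦ : ContDiff ℝ 2 Φ) {M₀ M₁ M₂ A : ℝ} (hM₀ : HasDecay 3 M₀ Φ)
    (hM₁ : HasDecay 3 M₁ (fderiv ℝ Φ)) (hM₂ : HasDecay 3 M₂ (fderiv ℝ (fderiv ℝ Φ)))
    (hLc : Continuous L) (hL : ∀ (x : (EuclideanSpace ℝ (Fin 3))) (r : ℝ), 1 ≤ r → ∫ y in ball x r, ‖L y‖ ≤ A * r) :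
    ContDiff ℝ 2 (fun x => ∫ y, L y (Φ (x - y))) ∧
      ∀ x a, fderiv ℝ (fun x' => fderiv ℝ (fun x => ∫ y, L y (Φ (x - y))) x' a) x a =
        ∫ y, L y (fderiv ℝ (fderiv ℝ Φ) (x - y) a a) := by
  have hΦ1 : ContDiff ℝ 1 Φ := hΦ.of_le one_le_two
  have hDΦ : ContDiff ℝ 1 (fderiv ℝ Φ) := hΦ.fderiv_right (m := 1) le_rfl
  have hM₁0 := hM₁.nonneg
  have hM₂0 := hM₂.nonneg
  -- the directional derivatives of `Φ`
  have hΦa : ∀ a, ContDiff ℝ 1 fun z => fderiv ℝ Φ z a := fun a => hDΦ.clm_apply contDiff_const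
  have hΦa0 : ∀ a, HasDecay 3 (M₁ * ‖a‖) (fun z => fderiv ℝ Φ z a) := fun a z => by
    calc ‖fderiv ℝ Φ z a‖ ≤ ‖fderiv ℝ Φ z‖ * ‖a‖ := ContinuousLinearMap.le_opNorm _ _
      _ ≤ M₁ * ((1 + ‖z‖) ^ 3)⁻¹ * ‖a‖ := mul_le_mul_of_nonneg_right (hM₁ z) (norm_nonneg _)
      _ = M₁ * ‖a‖ * ((1 + ‖z‖) ^ 3)⁻¹ := by ring
  have hΦa1 : ∀ a, HasDecay 3 (M₂ * ‖a‖) (fderiv ℝ (fun z => fderiv ℝ Φ z a)) := fun a z => by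
    have hd : DifferentiableAt ℝ (fderiv ℝ Φ) z := (hDΦ.differentiable one_ne_zero) z
    rw [fderiv_clm_apply hd (differentiableAt_const a)]
    simp only [fderiv_fun_const, Pi.zero_apply, ContinuousLinearMap.comp_zero, zero_add]
    refine ContinuousLinearMap.opNorm_le_bound _ (by positivity) fun w => ?_
    rw [ContinuousLinearMap.flip_apply]
    calc ‖fderiv ℝ (fderiv ℝ Φ) z w a‖ ≤ ‖fderiv ℝ (fderiv ℝ Φ) z w‖ * ‖a‖ :=
          ContinuousLinearMap.le_opNorm _ _
      _ ≤ ‖fderiv ℝ (fderiv ℝ Φ) z‖ * ‖w‖ * ‖a‖ := by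
          gcongr; exact ContinuousLinearMap.le_opNorm _ _
      _ ≤ M₂ * ((1 + ‖z‖) ^ 3)⁻¹ * ‖w‖ * ‖a‖ := by gcongr; exact hM₂ z
      _ = M₂ * ‖a‖ * ((1 + ‖z‖) ^ 3)⁻¹ * ‖w‖ := by ring
  -- first derivatives
  have hD1 : ∀ x, HasFDerivAt (fun x => ∫ y, L y (Φ (x - y)))
      (∫ y, (L y).comp (fderiv ℝ Φ (x - y))) x :=
    fun x => hasFDerivAt_integral_clm_apply_comp_sub_morrey hΦ1 hM₀ hM₁ hLc hL x
  have hfa : ∀ a, (fun x => fderiv ℝ (fun x => ∫ y, L y (Φ (x - y))) x a) =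
      fun x => ∫ y, L y ((fun z => fderiv ℝ Φ z a) (x - y)) := fun a =>
    funext fun x => fderiv_integral_clm_apply_comp_sub_apply_morrey hΦ1 hM₀ hM₁ hLc hL x a
  -- second derivatives
  have hD2 : ∀ a x, HasFDerivAt (fun x => ∫ y, L y ((fun z => fderiv ℝ Φ z a) (x - y)))
      (∫ y, (L y).comp (fderiv ℝ (fun z => fderiv ℝ Φ z a) (x - y))) x := fun a x =>
    hasFDerivAt_integral_clm_apply_comp_sub_morrey (hΦa a) (hΦa0 a) (hΦa1 a) hLc hL x
  -- continuity of the second derivatives: the weight `compL ∘ L` is again a Morrey weight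
  have hL'c : Continuous fun y => (ContinuousLinearMap.compL ℝ (EuclideanSpace ℝ (Fin 3)) F G) (L y) :=
    (ContinuousLinearMap.compL ℝ (EuclideanSpace ℝ (Fin 3)) F G).continuous.comp hLc
  have hL' : ∀ (x : (EuclideanSpace ℝ (Fin 3))) (r : ℝ), 1 ≤ r →
      ∫ y in ball x r, ‖(ContinuousLinearMap.compL ℝ (EuclideanSpace ℝ (Fin 3)) F G) (L y)‖ ≤
        (‖ContinuousLinearMap.compL ℝ (EuclideanSpace ℝ (Fin 3)) F G‖ * A) * r := by
    intro x r hr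
    have hint : IntegrableOn (fun y => ‖L y‖) (ball x r) volume :=
      (hLc.norm.continuousOn.integrableOn_compact (isCompact_closedBall x r)).mono_set
        ball_subset_closedBall
    calc ∫ y in ball x r, ‖(ContinuousLinearMap.compL ℝ (EuclideanSpace ℝ (Fin 3)) F G) (L y)‖
        ≤ ∫ y in ball x r, ‖ContinuousLinearMap.compL ℝ (EuclideanSpace ℝ (Fin 3)) F G‖ * ‖L y‖ := by
          refine setIntegral_mono_on ?_ (hint.const_mul _) measurableSet_ball fun y _ =>
            ContinuousLinearMap.le_opNorm _ _
          exact (hL'c.norm.continuousOn.integrableOn_compact (isCompact_closedBall x r)).mono_set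
            ball_subset_closedBall
      _ = ‖ContinuousLinearMap.compL ℝ (EuclideanSpace ℝ (Fin 3)) F G‖ * ∫ y in ball x r, ‖L y‖ := integral_const_mul _ _
      _ ≤ ‖ContinuousLinearMap.compL ℝ (EuclideanSpace ℝ (Fin 3)) F G‖ * (A * r) :=
          mul_le_mul_of_nonneg_left (hL x r hr) (norm_nonneg _)
      _ = (‖ContinuousLinearMap.compL ℝ (EuclideanSpace ℝ (Fin 3)) F G‖ * A) * r := by ring
  have hcont2 : ∀ a, Continuous fun x =>
      ∫ y, (L y).comp (fderiv ℝ (fun z => fderiv ℝ Φ z a) (x - y)) := fun a => by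
    have := continuous_integral_clm_apply_comp_sub_morrey (Φ := fderiv ℝ (fun z => fderiv ℝ Φ z a))
      (L := fun y => (ContinuousLinearMap.compL ℝ (EuclideanSpace ℝ (Fin 3)) F G) (L y))
      ((hΦa a).continuous_fderiv one_ne_zero) (hΦa1 a) hL'c hL'
    simpa using this
  refine ⟨?_, fun x a => ?_⟩
  · rw [show (2 : WithTop ℕ∞) = 1 + 1 from rfl, contDiff_succ_iff_fderiv_apply]
    refine ⟨fun x => (hD1 x).differentiableAt, fun h => absurd h (by norm_cast), fun a => ?_⟩
    rw [hfa a, contDiff_one_iff_fderiv]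
    refine ⟨fun x => (hD2 a x).differentiableAt, ?_⟩
    have : fderiv ℝ (fun x => ∫ y, L y ((fun z => fderiv ℝ Φ z a) (x - y))) =
        fun x => ∫ y, (L y).comp (fderiv ℝ (fun z => fderiv ℝ Φ z a) (x - y)) :=
      funext fun x => (hD2 a x).fderiv
    rw [this]
    exact hcont2 a
  · rw [hfa a, fderiv_integral_clm_apply_comp_sub_apply_morrey (hΦa a) (hΦa0 a) (hΦa1 a) hLc hL x a]
    refine integral_congr_ae (Eventually.of_forall fun y => ?_)
    have hd : DifferentiableAt ℝ (fderiv ℝ Φ) (x - y) := (hDΦ.differentiable one_ne_zero) _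
    simp only
    rw [fderiv_clm_apply hd (differentiableAt_const a)]
    simp

end Kernel

end Summit.NavierStokesRegularity.NavierStokesRegularity.Theorems.SingularProfile
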